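import Summits.BirchSwinnertonDyer.Rank1Residual.Additive.GordRatMainConjLowerBound
import Summits.BirchSwinnertonDyer.Rank1Residual.Additive.N10LowerHalfIwasawa
import HarnessLib

/-!
# The two typed `T = 0` LOWER inputs at an additive prime are EQUIVALENT, and the shared algebra of the
# rational-main-conjecture-plus-certificate mechanism (cell `b2b-bsdres`, team n1011, seat n1011-p06,
# OWNERS row T-N10R, phase 3a)

HONEST FRAMING (cell `b2b-bsdres`, run/shared/lean/b2b/bsd-rank1-residual/, verbatim in every
file): the goal of the cell is to DELETE the COMBINATION-SHAPED residual classes of the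
Birch–Swinnerton-Dyer formula for ALL analytic-rank `≤ 1` elliptic curves over `ℚ` — "full BSD
formula for every rank `≤ 1` curve in class `C`" assembled STRICTLY from published theorems — so
that the rank-`≤ 1` remainder becomes exactly the CONSTRUCTION-SHAPED classes, which are TYPED
(missing-input `Prop`s), NOT attempted. This is not "finishing BSD". Team n1011 (X4 ∧ `p = 3` / the
additive block, §I items N10 / N11): research routes; prove what is provable now; no claim beyond
the stated classes; X4(M) / X4♯(G-ord) stay CONSTRUCTION-SHAPED; labels / census / located gap
UNCHANGED; nothing is booked. Theorems only; no definition, no named fact.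

* `cycLeadingTermDvdAt_of_cycLowerLeadingTermAt` (+ `cycLeadingTermDvdAt_iff_cycLowerLeadingTermAt`, the
  converse being cc-typer-2's `N10.cycLowerLeadingTermAt_of_cycLeadingTermDvdAt`,
  `N10LowerHalfIwasawa.lean`): additive-p2's `CycLowerLeadingTermAt W p` (gen 18,
  `GordCharLeadingTerm.lean`: for every GENERATOR `f` of `char_Λ X(E/ℚ_∞)`, `L(E,1)/Ω_E ∣ f(0)` in
  `ℤ_p`) and n1011-p18's `CycLeadingTermDvdAt W p` (`CycLeadingTermDvd.lean`: the same for every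
  ELEMENT of `char`) coincide — `char` is principal (`charIdeal_isPrincipal_holds`), an element is a
  multiple of a generator, a generator is an element. So every consumer of either input serves both:
  the (M)-locus Miller-currency consumers of p18 (`ClassX4M.missingLowerBoundAt_rankZero_of_cycLeadingTermDvd`,
  Delbourgo 1998 Prop. 4 exact on (M)) apply to additive-p2's input, and additive-p2's (G)-locus
  consumers (Delbourgo 2002) apply to p18's.
* `exists_padicInt_constantCoeff_generator_of_pow_mul`: if one generator `g` has `g(0) = p^m · X`,
  `X = w · q` with `w ∈ ℤ_p`, then every generator has `f'(0) = c · q`, `c ∈ ℤ_p` — the algebra behind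
  this seat's `cycLowerLeadingTermAt_of_chiBranchRatCharEq[Odd]_of_unitCoeff` and the (M)-locus twins
  (`PotMultRatMainConjLowerBound[Odd].lean`).

References: Delbourgo, Compositio Math. 113 (1998) Main Conjecture p. 151 [Delbourgo1998]; Greenberg,
LNM 1716 (1999) §1 [GreenbergLNM1716].
-/

noncomputable section

open scoped Classical MatrixGroups ModularForm NumberField

open CongruenceSubgroup WeierstrassCurve NumberField Literature.NumberTheory.EllipticCurves
  Literature.NumberTheory.EllipticCurves.ModularForms
  Literature.NumberTheory.EllipticCurves.Rank1Residual
  Literature.NumberTheory.EllipticCurves.Rank1Residual.Typed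
  IsDedekindDomain

namespace Summit.BirchSwinnertonDyer.Rank1Residual.Additive

variable (W : WeierstrassCurve ℚ) [W.IsElliptic] [W.IsGloballyMinimal] (p : ℕ) [hp : Fact p.Prime]

/-! ### §1 The two typed `T = 0` lower inputs are equivalent -/

omit [W.IsElliptic] [W.IsGloballyMinimal] in
variable {W p} in
/-- **Generator form ⟹ element form.** additive-p2's `CycLowerLeadingTermAt W p` ("for every
GENERATOR `f` of `char_Λ X(E/ℚ_∞)`, `L(E,1)/Ω_E ∣ f(0)`") implies n1011-p18's `CycLeadingTermDvdAt W p`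
("for every ELEMENT `g` of `char`"): `char` is principal (`charIdeal_isPrincipal_holds`) and
`g = a · f` gives `g(0) = a(0) · f(0)`. Bookkeeping. [cite: Delbourgo1998, Main Conjecture (p. 151) (shape)] -/
theorem cycLeadingTermDvdAt_of_cycLowerLeadingTermAt (h : CycLowerLeadingTermAt W p) :
    CycLeadingTermDvdAt W p := by
  intro κ γ hκ hγ hγ' D g hg
  haveI : (Module.charIdeal (IwasawaAlgebra p) D.X).IsPrincipal := charIdeal_isPrincipal_holds p D.X
  obtain ⟨f, hf⟩ := Submodule.IsPrincipal.principal (Module.charIdeal (IwasawaAlgebra p) D.X)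
  obtain ⟨q, hLq, c, hf0⟩ := h κ γ hκ hγ hγ' D f hf
  have hg' : g ∈ Ideal.span ({f} : Set (IwasawaAlgebra p)) := by
    change g ∈ Module.charIdeal (IwasawaAlgebra p) D.X at hg
    rwa [hf] at hg
  obtain ⟨a, rfl⟩ := Ideal.mem_span_singleton'.mp hg'
  refine ⟨PowerSeries.constantCoeff a * c, q, hLq, ?_⟩
  simp only [map_mul, PadicInt.coe_mul, hf0]
  ring

omit [W.IsElliptic] [W.IsGloballyMinimal] in
variable {W p} in
/-- The two typed `T = 0` lower inputs coincide. [cite: Delbourgo1998, Main Conjecture (p. 151) (shape)] -/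
theorem cycLeadingTermDvdAt_iff_cycLowerLeadingTermAt :
    CycLeadingTermDvdAt W p ↔ CycLowerLeadingTermAt W p :=
  ⟨N10.cycLowerLeadingTermAt_of_cycLeadingTermDvdAt W p, cycLeadingTermDvdAt_of_cycLowerLeadingTermAt⟩

/-! ### §2 The shared algebra of the rational-MC-plus-certificate mechanism -/

omit [W.IsElliptic] [W.IsGloballyMinimal] in
variable {W p} in
/-- **Shared algebra of the rational-MC-plus-certificate mechanism.** If a generator `g` of
`char_Λ X` has `g(0) = p^m · X` in `ℚ_p` with `X = w · q`, `w ∈ ℤ_p`, then every generator `f'` has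
`f'(0) = c · q` with `c ∈ ℤ_p` (`f' = g·v`, `v ∈ Λ^×`; `c = v(0) p^m w`). [folklore] -/
theorem exists_padicInt_constantCoeff_generator_of_pow_mul {κ : ZpExtension ℚ p}
    {γ : Field.absoluteGaloisGroup ℚ} (D : W.SelmerDualData κ γ) {g f' : IwasawaAlgebra p}
    (hg : D.charIdeal = Ideal.span {g}) (hf' : D.charIdeal = Ideal.span {f'})
    {m : ℕ} {X : ℚ_[p]} (hg0 : ((PowerSeries.constantCoeff g : ℤ_[p]) : ℚ_[p]) = (p : ℚ_[p]) ^ m * X)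
    {q : ℚ} (w : ℤ_[p]) (hX : X = (w : ℚ_[p]) * (q : ℚ_[p])) :
    ∃ c : ℤ_[p], ((PowerSeries.constantCoeff f' : ℤ_[p]) : ℚ_[p]) = (c : ℚ_[p]) * (q : ℚ_[p]) := by
  obtain ⟨v, rfl⟩ := exists_units_mul_eq_of_span_eq D hg hf'
  refine ⟨PowerSeries.constantCoeff (v : IwasawaAlgebra p) * (p : ℤ_[p]) ^ m * w, ?_⟩
  simp only [map_mul, PadicInt.coe_mul, PadicInt.coe_pow, PadicInt.coe_natCast]
  rw [hg0, hX]
  ring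

end Summit.BirchSwinnertonDyer.Rank1Residual.Additive

end
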